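import Summits.CriticalPhenomena.SAWScalingLimit.Theses.SAWCutPointCondensation
import Literature.Probability.RandomPlanarGeometry.BlobTimeDomainLaw
import Literature.Probability.RandomPlanarGeometry.SAWScalingLimitFamily

/-!
# Birth skeleton (BC3) for the crux `SAWCutPointCondensation.CutPointWindowLimit`

Crux item stmt-CriticalPhenomena-7349 (rank 5, the WINDOW) of
`route-CriticalPhenomena-SAWCutPointCondensation` (`CriticalPhenomena/SAWScalingLimit`), concluded
BY NAME by `CutPointWindowLimit_of` below:

  for every `g > 0` there is a chordal family `Q` (`ChordalFamily.IsChordal`) such that, for every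
  Dobrushin domain `D` and every endpoint approximation `(a_δ, b_δ)` (`SAW.IsEndpointApprox`), the
  critical blob-time laws in the near-Brownian window `t = exp (-g δ^{3/4})`,
  `BL^g_δ := BlobTime.domainLaw (exp (-(g δ^{3/4}))) D.carrier δ (a δ) (b δ)`
  (by `BlobTime.domainLaw_eq` this is, by `rfl`, the ≈ 600-character term inlined in the crux),
  converge weakly to `Q D` as `δ → 0⁺` (`TendstoLaw` with the identity variable).

## The line: the classical three-legged weak-convergence scheme, typed

* `stub_windowTight` (T, TIGHTNESS / NO MASS ESCAPE, hardest a-priori input): along every endpoint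
  approximation the window laws are, for `δ ∈ (0, δ₀]`, probability measures (total mass
  `Z ∉ {0, ∞}`: `a_δ, b_δ` joined; `#cut times ≤ |V(Ω_δ)|` and `t·y_c(t) ≤ 1/4 < 1/λ₁(Ω_δ)`) forming
  a TIGHT set on the Polish space `CurveClass ℂ` (Aizenman–Burchard / Kemppainen–Smirnov-type
  annulus-crossing bounds for the tilted excursion at exact whole-plane criticality `y_c(t)`; this
  is where "mass escapes to long/short walks" — the crux's declared failure mode — would bite).
* `stub_windowSubseqLimitsIdentified` (I, IDENTIFICATION / UNIQUENESS): for every `g > 0` and `D`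
  there is ONE measure `μ_g(D)` such that every sequential weak limit point of the window laws,
  along ANY endpoint approximation of `D` and ANY sequence `δ_n → 0⁺`, equals `μ_g(D)` (intended:
  the Brownian excursion of `(D; a, b)` tilted by `exp (g c₁ 𝓜_{3/4}(cut points) − θ_c(g) τ)`,
  via KMT coupling + GaoLiPanovShiraishi2026 Thm 1.1 + uniform exponential moments; in particular
  the limit does not remember the lattice approximation of the prime ends).
* `stub_windowLimitsChordal` (B, BOUNDARY BEHAVIOUR): every such sequential limit point is carried
  by curves from `a = D.pt 0` to `b = D.pt 1` inside `closure D` (portmanteau on the closed sets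
  `{dist (γ.source, a) ≤ ε}`, `{γ ⊆ closure (cthickening ε D)}`; mesh polylines leave `D̄` by at most
  `δ`; `δ·a_δ → a`, `δ·b_δ → b`).

`CutPointWindowLimit_of` (T) → (I) → (B) → crux (hypotheses under the registered aliases
`Registered.stub_*`; `CutPointWindowLimit_proof` wires the three stubs in) is a REAL proof (≈ 70 lines):
`Q := μ` (choice over (I)); Prokhorov (Mathlib `isCompact_closure_of_isTightMeasureSet`) + Lévy–Prokhorov
metrisability of `ProbabilityMeasure (CurveClass ℂ)` turn (T) into sequential compactness
(`exists_subseq_tendsto_of_tight`); (I) identifies every subsequential limit with `μ D`, (B) makes it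
chordal (an endpoint approximation of every Dobrushin domain exists: tree theorem
`SAW.exists_isEndpointApprox`), and the subsequence principle along the countably generated
filter `𝓝[>] 0` (`Filter.tendsto_of_subseq_tendsto`) upgrades "every sequence has a subsequence
converging to `μ D`" to `TendstoLaw`.  No stub is the crux or the summit reworded: (T) has no limit
object, (I) has no existence, (B) has neither (BC3 probes `stub → crux`, `stub → SAWScalingLimit`
by `first | exact? | simpa | aesop` all fail; see NOTES.md of the registering seat).

Disproof used: none on file for this crux (`ledger crux ls stmt-CriticalPhenomena-7349`: no
`Disproof.lean` yet).  Negatives index: no tightness statement uniform in the domain / the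
approximation is asserted (cf. stmt-CriticalPhenomena-0772): `δ₀` in (T) depends on `(g, D, a, b)`.
-/

namespace Summit.CriticalPhenomena.SAWScalingLimit.Cruxes.CutPointWindowLimit.Birth

open MeasureTheory Filter Topology Set
open Literature.Probability.RandomPlanarGeometry Literature.Probability.LatticeModels
open scoped BoundedContinuousFunction

/-! ### The three statements of the line, named -/

/-- **(T) Tightness of the window laws, no mass escape.** For `g > 0`, a Dobrushin domain `D` and an
endpoint approximation `(a_δ, b_δ)` there is `δ₀ > 0` such that the window laws `BL^g_δ(D; a_δ, b_δ)`,
`δ ∈ (0, δ₀]`, are probability measures and form a tight set of measures on `CurveClass ℂ`. -/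
def WindowTight : Prop :=
    ∀ g : ℝ, 0 < g → ∀ (D : DobrushinDomain) (a b : ℝ → Site 2), SAW.IsEndpointApprox D a b →
      ∃ δ₀ : ℝ, 0 < δ₀ ∧
        (∀ δ ∈ Set.Ioc (0 : ℝ) δ₀, IsProbabilityMeasure
          (BlobTime.domainLaw (Real.exp (-(g * δ ^ (3 / 4 : ℝ)))) D.carrier δ (a δ) (b δ))) ∧
        IsTightMeasureSet ((fun δ : ℝ =>
          BlobTime.domainLaw (Real.exp (-(g * δ ^ (3 / 4 : ℝ)))) D.carrier δ (a δ) (b δ)) ''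
            Set.Ioc (0 : ℝ) δ₀)

/-- **(I) Identification: one candidate law absorbs every subsequential limit.** For `g > 0` and a
Dobrushin domain `D` there is a measure `μ = μ_g(D)` on `CurveClass ℂ` such that for every endpoint
approximation `(a_δ, b_δ)` of `D`, every sequence `δ_n → 0⁺` and every probability measure `ν`: if
`BL^g_{δ_n}(D; a_{δ_n}, b_{δ_n}) → ν` weakly, then `ν = μ`. -/
def WindowSubseqLimitsIdentified : Prop :=
    ∀ g : ℝ, 0 < g → ∀ D : DobrushinDomain, ∃ μ : Measure (CurveClass ℂ),
      ∀ (a b : ℝ → Site 2), SAW.IsEndpointApprox D a b →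
        ∀ δs : ℕ → ℝ, Tendsto δs atTop (𝓝[>] (0 : ℝ)) →
          ∀ ν : Measure (CurveClass ℂ), IsProbabilityMeasure ν →
            (∀ f : CurveClass ℂ →ᵇ ℝ, Tendsto (fun n => ∫ x, f x
                ∂(BlobTime.domainLaw (Real.exp (-(g * δs n ^ (3 / 4 : ℝ)))) D.carrier (δs n)
                    (a (δs n)) (b (δs n)))) atTop (𝓝 (∫ x, f x ∂ν))) →
            ν = μ

/-- **(B) Boundary behaviour of limit points.** Every sequential weak limit point `ν` of the window
laws along an endpoint approximation of `D` is carried by curves running from `a = D.pt 0` to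
`b = D.pt 1` inside `closure D`. -/
def WindowLimitsChordal : Prop :=
    ∀ g : ℝ, 0 < g → ∀ (D : DobrushinDomain) (a b : ℝ → Site 2), SAW.IsEndpointApprox D a b →
      ∀ δs : ℕ → ℝ, Tendsto δs atTop (𝓝[>] (0 : ℝ)) →
        ∀ ν : Measure (CurveClass ℂ), IsProbabilityMeasure ν →
          (∀ f : CurveClass ℂ →ᵇ ℝ, Tendsto (fun n => ∫ x, f x
              ∂(BlobTime.domainLaw (Real.exp (-(g * δs n ^ (3 / 4 : ℝ)))) D.carrier (δs n)
                  (a (δs n)) (b (δs n)))) atTop (𝓝 (∫ x, f x ∂ν))) →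
          ∀ᵐ γ ∂ν, γ.source = D.pt 0 ∧ γ.target = D.pt 1 ∧ γ.range ⊆ closure D.carrier

/-! ### The stubs (the ONLY `sorry`s of the file)

Each stub is stated over TREE VOCABULARY ONLY (verbatim the body of the named statement above), so it
lands as `Theorems/SAWCutPointCondensationCutPointWindowLimit<Stub>.lean --supports stmt-CriticalPhenomena-7349`
without importing this workfile; `Registered.stub_*` below are the reducible aliases under which the
skeleton audit admits them as hypotheses of `CutPointWindowLimit_of`. -/

/-- Stub T = `WindowTight` verbatim (tightness / no mass escape of the window laws). -/
theorem stub_windowTight :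
    ∀ g : ℝ, 0 < g → ∀ (D : DobrushinDomain) (a b : ℝ → Site 2), SAW.IsEndpointApprox D a b →
      ∃ δ₀ : ℝ, 0 < δ₀ ∧
        (∀ δ ∈ Set.Ioc (0 : ℝ) δ₀, IsProbabilityMeasure
          (BlobTime.domainLaw (Real.exp (-(g * δ ^ (3 / 4 : ℝ)))) D.carrier δ (a δ) (b δ))) ∧
        IsTightMeasureSet ((fun δ : ℝ =>
          BlobTime.domainLaw (Real.exp (-(g * δ ^ (3 / 4 : ℝ)))) D.carrier δ (a δ) (b δ)) ''
            Set.Ioc (0 : ℝ) δ₀) := by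
  sorry

/-- Stub I = `WindowSubseqLimitsIdentified` verbatim (identification of subsequential limits). -/
theorem stub_windowSubseqLimitsIdentified :
    ∀ g : ℝ, 0 < g → ∀ D : DobrushinDomain, ∃ μ : Measure (CurveClass ℂ),
      ∀ (a b : ℝ → Site 2), SAW.IsEndpointApprox D a b →
        ∀ δs : ℕ → ℝ, Tendsto δs atTop (𝓝[>] (0 : ℝ)) →
          ∀ ν : Measure (CurveClass ℂ), IsProbabilityMeasure ν →
            (∀ f : CurveClass ℂ →ᵇ ℝ, Tendsto (fun n => ∫ x, f x
                ∂(BlobTime.domainLaw (Real.exp (-(g * δs n ^ (3 / 4 : ℝ)))) D.carrier (δs n)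
                    (a (δs n)) (b (δs n)))) atTop (𝓝 (∫ x, f x ∂ν))) →
            ν = μ := by
  sorry

/-- Stub B = `WindowLimitsChordal` verbatim (limit points are chordal). -/
theorem stub_windowLimitsChordal :
    ∀ g : ℝ, 0 < g → ∀ (D : DobrushinDomain) (a b : ℝ → Site 2), SAW.IsEndpointApprox D a b →
      ∀ δs : ℕ → ℝ, Tendsto δs atTop (𝓝[>] (0 : ℝ)) →
        ∀ ν : Measure (CurveClass ℂ), IsProbabilityMeasure ν →
          (∀ f : CurveClass ℂ →ᵇ ℝ, Tendsto (fun n => ∫ x, f x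
              ∂(BlobTime.domainLaw (Real.exp (-(g * δs n ^ (3 / 4 : ℝ)))) D.carrier (δs n)
                  (a (δs n)) (b (δs n)))) atTop (𝓝 (∫ x, f x ∂ν))) →
          ∀ᵐ γ ∂ν, γ.source = D.pt 0 ∧ γ.target = D.pt 1 ∧ γ.range ⊆ closure D.carrier := by
  sorry

/-! ### Registered names of the stub statements

The skeleton audit (`#h21_check_skeleton`) admits as hypotheses of `CutPointWindowLimit_of` only
propositions whose head constant is NAMED like a declared stub, so each statement gets a reducible
alias carrying its stub's name. -/
namespace Registered

/-- `WindowTight`, under the name of its stub. -/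
abbrev stub_windowTight : Prop := WindowTight
/-- `WindowSubseqLimitsIdentified`, under the name of its stub. -/
abbrev stub_windowSubseqLimitsIdentified : Prop := WindowSubseqLimitsIdentified
/-- `WindowLimitsChordal`, under the name of its stub. -/
abbrev stub_windowLimitsChordal : Prop := WindowLimitsChordal

end Registered

/-! ### Proved glue -/

/-- The window law `BL^g_δ(D; a_δ, b_δ)` (file-local abbreviation; by `BlobTime.domainLaw_eq` it is,
by `rfl`, the term inlined in the crux). -/
noncomputable abbrev windowLaw (g : ℝ) (D : DobrushinDomain) (a b : ℝ → Site 2) (δ : ℝ) :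
    Measure (CurveClass ℂ) :=
  BlobTime.domainLaw (Real.exp (-(g * δ ^ (3 / 4 : ℝ)))) D.carrier δ (a δ) (b δ)

/-- **Sequential Prokhorov compactness along `δ → 0⁺`.** If the laws `F δ`, `δ ∈ (0, δ₀]`, are
probability measures forming a tight set, then along every sequence `δ_n → 0⁺` some subsequence of
`F (δ_n)` converges weakly (against bounded continuous functions) to a probability measure.
Mathlib's Prokhorov theorem `isCompact_closure_of_isTightMeasureSet` and the Lévy–Prokhorov
metrisability of `ProbabilityMeasure (CurveClass ℂ)`; the finitely many `δ_n ∉ (0, δ₀]` are padded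
with the junk value `F δ₀`. -/
theorem exists_subseq_tendsto_of_tight {F : ℝ → Measure (CurveClass ℂ)} {δ₀ : ℝ} (hδ₀ : 0 < δ₀)
    (hprob : ∀ δ ∈ Set.Ioc (0 : ℝ) δ₀, IsProbabilityMeasure (F δ))
    (htight : IsTightMeasureSet (F '' Set.Ioc (0 : ℝ) δ₀))
    {δs : ℕ → ℝ} (hδs : Tendsto δs atTop (𝓝[>] (0 : ℝ))) :
    ∃ φ : ℕ → ℕ, StrictMono φ ∧ ∃ ν : Measure (CurveClass ℂ), IsProbabilityMeasure ν ∧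
      ∀ f : CurveClass ℂ →ᵇ ℝ,
        Tendsto (fun n => ∫ x, f x ∂(F (δs (φ n)))) atTop (𝓝 (∫ x, f x ∂ν)) := by
  classical
  have hδ₀mem : δ₀ ∈ Set.Ioc (0 : ℝ) δ₀ := ⟨hδ₀, le_rfl⟩
  -- pad the (finitely many) indices with `δs n ∉ (0, δ₀]` by the junk value `δ₀`
  obtain ⟨δs', hmem, heq⟩ : ∃ δs' : ℕ → ℝ, (∀ n, δs' n ∈ Set.Ioc (0 : ℝ) δ₀) ∧
      ∀ n, δs n ∈ Set.Ioc (0 : ℝ) δ₀ → δs' n = δs n := by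
    refine ⟨fun n => if δs n ∈ Set.Ioc (0 : ℝ) δ₀ then δs n else δ₀, fun n => ?_, fun n hn => ?_⟩
    · dsimp only
      split_ifs with h
      · exact h
      · exact hδ₀mem
    · dsimp only
      rw [if_pos hn]
  -- lift to `ProbabilityMeasure (CurveClass ℂ)`
  obtain ⟨P, hP⟩ : ∃ P : ℕ → ProbabilityMeasure (CurveClass ℂ),
      ∀ n, (P n : Measure (CurveClass ℂ)) = F (δs' n) :=
    ⟨fun n => ⟨F (δs' n), hprob _ (hmem n)⟩, fun n => rfl⟩
  set S : Set (ProbabilityMeasure (CurveClass ℂ)) :=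
    {Q | (Q : Measure (CurveClass ℂ)) ∈ F '' Set.Ioc (0 : ℝ) δ₀} with hS_def
  have hPS : ∀ n, P n ∈ S := fun n => by
    rw [hS_def, Set.mem_setOf_eq, hP n]
    exact ⟨δs' n, hmem n, rfl⟩
  have hS : IsTightMeasureSet
      {((Q : ProbabilityMeasure (CurveClass ℂ)) : Measure (CurveClass ℂ)) | Q ∈ S} := by
    refine htight.subset ?_
    rintro _ ⟨Q, hQ, rfl⟩
    exact hQ
  -- Prokhorov + Lévy–Prokhorov metrisability: a weakly convergent subsequence
  obtain ⟨ν, -, φ, hφ, hlim⟩ :=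
    (isCompact_closure_of_isTightMeasureSet hS).tendsto_subseq (x := P)
      fun n => subset_closure (hPS n)
  refine ⟨φ, hφ, ν, inferInstance, fun f => ?_⟩
  have h1 := (ProbabilityMeasure.tendsto_iff_forall_integral_tendsto.1 hlim) f
  have hev : ∀ᶠ n in atTop, δs (φ n) ∈ Set.Ioc (0 : ℝ) δ₀ :=
    hφ.tendsto_atTop.eventually (hδs.eventually (Ioc_mem_nhdsGT hδ₀))
  refine h1.congr' ?_
  filter_upwards [hev] with n hn
  rw [Function.comp_apply, hP, heq _ hn]

/-! ### The skeleton theorem: (T) → (I) → (B) → the crux, BY NAME -/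

/-- **`CutPointWindowLimit` from the line `birth`** (kernel-checked, no `sorry` of its own):
`Q := μ` by choice over (I); Prokhorov turns (T) into sequential compactness; (I) identifies every
subsequential limit with `μ D`, (B) makes it chordal (an endpoint approximation of every Dobrushin domain
exists, `SAW.exists_isEndpointApprox`); the subsequence principle along the countably generated filter
`𝓝[>] 0` upgrades this to `TendstoLaw`.  Hypotheses = the three stubs, under their registered names. -/
theorem CutPointWindowLimit_of (hT : Registered.stub_windowTight)
    (hI : Registered.stub_windowSubseqLimitsIdentified) (hB : Registered.stub_windowLimitsChordal) :
    Summit.CriticalPhenomena.SAWScalingLimit.Theses.SAWCutPointCondensation.CutPointWindowLimit := by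
  dsimp only [Registered.stub_windowTight, Registered.stub_windowSubseqLimitsIdentified,
    Registered.stub_windowLimitsChordal, WindowTight, WindowSubseqLimitsIdentified,
    WindowLimitsChordal] at hT hI hB
  intro g hg
  classical
  -- the candidate family, by choice over (I)
  choose μ hμ using hI g hg
  -- KEY: along every approximation and every sequence `δ_n → 0⁺` some subsequence of the window
  -- laws converges weakly to `μ D`, which is then a chordal probability law ((T) + Prokhorov,
  -- identified by (I), chordal by (B))
  have key : ∀ (D : DobrushinDomain) (a b : ℝ → Site 2), SAW.IsEndpointApprox D a b →
      ∀ δs : ℕ → ℝ, Tendsto δs atTop (𝓝[>] (0 : ℝ)) →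
        ∃ φ : ℕ → ℕ, StrictMono φ ∧ IsProbabilityMeasure (μ D) ∧
          (∀ᵐ γ ∂(μ D), γ.source = D.pt 0 ∧ γ.target = D.pt 1 ∧ γ.range ⊆ closure D.carrier) ∧
          ∀ f : CurveClass ℂ →ᵇ ℝ,
            Tendsto (fun n => ∫ x, f x ∂(windowLaw g D a b (δs (φ n)))) atTop
              (𝓝 (∫ x, f x ∂(μ D))) := by
    intro D a b hab δs hδs
    obtain ⟨δ₀, hδ₀, hprob, htight⟩ := hT g hg D a b hab
    obtain ⟨φ, hφ, ν, hν, hlim⟩ :=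
      exists_subseq_tendsto_of_tight (F := windowLaw g D a b) hδ₀ hprob htight hδs
    have hδsφ : Tendsto (fun n => δs (φ n)) atTop (𝓝[>] (0 : ℝ)) := hδs.comp hφ.tendsto_atTop
    have hνμ : ν = μ D := hμ D a b hab (fun n => δs (φ n)) hδsφ ν hν hlim
    have hch := hB g hg D a b hab (fun n => δs (φ n)) hδsφ ν hν hlim
    refine ⟨φ, hφ, ?_, ?_, ?_⟩
    · rw [← hνμ]; exact hν
    · rw [← hνμ]; exact hch
    · rw [← hνμ]; exact hlim
  refine ⟨μ, ?_, ?_⟩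
  · -- `μ` is chordal: run KEY along some endpoint approximation (one exists for every Dobrushin
    -- domain, `SAW.exists_isEndpointApprox`) and the sequence `δ_n = 1/(n+1)`
    intro D
    obtain ⟨a, b, hab⟩ := SAW.exists_isEndpointApprox D
    have hδs : Tendsto (fun n : ℕ => 1 / ((n : ℝ) + 1)) atTop (𝓝[>] (0 : ℝ)) :=
      tendsto_nhdsWithin_iff.2 ⟨tendsto_one_div_add_atTop_nhds_zero_nat,
        Eventually.of_forall fun n => Set.mem_Ioi.2 Nat.one_div_pos_of_nat⟩
    obtain ⟨-, -, hP, hch, -⟩ := key D a b hab _ hδs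
    exact ⟨hP, hch⟩
  · -- weak convergence along `δ → 0⁺`: every sequence has a subsequence along which the
    -- integrals converge to `∫ f d(μ D)` (KEY), and `𝓝[>] 0` is countably generated
    intro D a b hab f
    refine tendsto_of_subseq_tendsto fun δs hδs => ?_
    obtain ⟨φ, -, -, -, hlim⟩ := key D a b hab δs hδs
    exact ⟨φ, hlim f⟩

/-- **The crux proof modulo the stubs** (wiring check: the three stubs, exactly as stated over tree
vocabulary, feed the skeleton theorem; this term becomes the crux proof when the last `sorry` above is
discharged — it has no `sorry` of its own). -/
theorem CutPointWindowLimit_proof :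
    Summit.CriticalPhenomena.SAWScalingLimit.Theses.SAWCutPointCondensation.CutPointWindowLimit :=
  CutPointWindowLimit_of stub_windowTight stub_windowSubseqLimitsIdentified stub_windowLimitsChordal

end Summit.CriticalPhenomena.SAWScalingLimit.Cruxes.CutPointWindowLimit.Birth
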